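import Summits.HodgeConjecture.HodgeConjecture.Theorems.VHCAbelianSchemesRoadDesignDefs
import Summits.HodgeConjecture.HodgeConjecture.Theorems.VHCAbelianSchemesRoadLefschetzSlackPin
import Summits.HodgeConjecture.HodgeConjecture.Theorems.VHCAbelianSchemesRoadDegreeConfinement
import Summits.HodgeConjecture.HodgeConjecture.Theorems.Ring2BindersAbelianSchemeVHCShadow
import Literature.AlgebraicGeometry.HodgeTheory.AlgebraicClassesCupDivisorHolds
import Literature.AlgebraicGeometry.HodgeTheory.AlgebraicClassesHodgeTypeHolds
import HarnessLib

/-!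
# Road b02 (`VHCAbelianSchemesRoad`) — THE PINNED DESIGN PROBLEM ON ONE ABELIAN VARIETY IMPLIES THE CELL (sufficient side of the sandwich)

research route conditional on HC_CM; not a corollary; Q11.4-sentence-2 already refuted in dim ≥ 3.

Door-generic and FACT-FREE. For an object class `𝒪 : ObjClass` and a cell `(n, p)`:

* §1 `cupPowTwo_mem_algebraicClasses_of_mem` — powers of a class supported on a divisor are algebraic on every smooth projective complex
  variety (the tree's Voisin II Prop. 9.20 for a cycle and a divisor, iterated); `isOfHodgeType_map_cupPowTwo` bookkeeping.
* §2 **`admissibleRepresentativesLefAtDeg_of_pinnedDesignAt : PinnedDesignAt 𝒪 n p → AdmissibleRepresentativesLefAtDeg 𝒪 n p`** — the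
  per-variety PINNED DESIGN PROBLEM (an `𝒪`-datum ON each abelian `n`-fold `X` with `κ_p = a·w + c·θᵖ`, sides on the `θ`-ray, for every
  polarisation class `θ` and every rational algebraic `w`) gives K-SR♭∃ at `(n, p)` — BOTH regimes — on EVERY one-parameter abelian scheme of
  the crux's shape: the relative hyperplane class `Θ = ε^* r₀` of the quasi-projective total space polarises every fibre (ring2-b02's
  `exists_forall_isPolarizationClass_map_fiberι`), the design is solved at the fibre `s₀` where `W` is algebraic with `θ := Θ|_{s₀}`, and the
  global classes `V_p := a·W + c_p·Θᵖ`, `V_q := c_q·Θ^q`, `Z := c_p·Θᵖ` are a K-SR♭∃ datum (`lefAtDatum_of_pinned`, PART V). Hence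
  `lefAtExceptionalRegimeAt_of_pinnedDesignAt` (regime 2 at `(n, p)`), and the ungraded `admissibleRepresentativesLefAt_of_forall_pinnedDesignAt`.
* §3 **`lefAtExceptionalRegimeAt_of_pinnedHodgeDesignAt : PinnedHodgeDesignAt 𝒪 n p → LefAtExceptionalRegimeAt 𝒪 n p`** — the HODGE form
  (rational `(p,p)` classes OFF the Lefschetz span) gives REGIME 2: the datum is placed at the fibre where `W` is exceptional (it exists by
  the regime hypothesis, Lefschetz classes being algebraic — `divisorClassesSpan_le_algebraicClasses_of_isSmoothProjective`).
* §5 (appended) the engine PER PENCIL, PER FIBRE: `exists_lefAtDatum_of_pinnedDatum_at` — ONE pinned datum at ONE fibre w.r.t. ANY global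
  class `Θ` with rational `(1,1)` restrictions is a K-SR♭∃ datum for that pencil (for per-variety inputs known at special fibres only, e.g.
  the anchor sixfold of a split Weil component); `exists_lefAtDatum_of_pinnedDesign_at_fibre` (relative hyperplane class).
* §4 The content of the pinned design is OFF THE `θ`-RAY: for a door with null data, classes `w ∈ ℂ·θᵖ` are served by the null datum
  (`pinnedDesign_of_mem_span_cupPowTwo_of_hasNullDatum`, `pinnedDesignAt_iff_offRay_of_hasNullDatum`); and under the Hodge conjecture in
  codimension `p` for the varieties concerned the algebraic form implies the Hodge form (`pinnedHodgeDesignAt_of_pinnedDesignAt_of_hodge`).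

What is NOT claimed: any design problem, any cell, K-SR♭∃, VHC, `HC_AV`, HC; `HC_CM` occurs nowhere. The converse direction (a cell implies a
per-variety design problem MODULO LEFSCHETZ CLASSES) is the companion file `VHCAbelianSchemesRoadDesignNecessary`.
References: [cite: Bloch1972Semiregularity, Remark (7.5)] [cite: BuchweitzFlenner2003, §5 Thm. 5.1] [cite: vanGeemen1994HodgeAV, §2.4 and
Thm. 4.11] [cite: VoisinHodgeI2002, Thm. 6.25, Thm. 7.10 and §7.1.2] [cite: VoisinHodgeII2003, §9.2.4 Prop. 9.20].
-/

noncomputable section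

open CategoryTheory CategoryTheory.Limits AlgebraicGeometry Topology

-- the cell's namespace repeats the summit name (`Summit.HodgeConjecture.HodgeConjecture…`), as in every `Ring2*` file
set_option linter.dupNamespace false

namespace Summit.HodgeConjecture.HodgeConjecture.Ring2.SemiregularRepresentatives

open Literature.AlgebraicGeometry Literature.AlgebraicGeometry.Motives
open Literature.AlgebraicGeometry.HodgeTheory
open Literature.AlgebraicTopology.SingularHomology
open Literature.Barriers.HodgeConjecture (divisorClassesSpan)
open Summit.Ventures.HSemireg (ObjClass)
open Summit.HodgeConjecture.HodgeConjecture.Ring2.Binders (exists_forall_isPolarizationClass_map_fiberι)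

/-! ## §1 Powers of a polarisation class: algebraic, of Hodge type `(q,q)` -/

/-- **`θ ∈ N¹H² ⟹ θ^q ∈ N^q H^{2q}`** on a smooth projective complex variety (Voisin II Prop. 9.20 for a cycle and a divisor — the tree's
`cupProduct_mem_algebraicClasses_one_right` — iterated; `θ⁰ = 1` is algebraic in codimension `0`). [cite: VoisinHodgeII2003, §9.2.4 Prop. 9.20] -/
theorem cupPowTwo_mem_algebraicClasses_of_mem {n : ℕ} {X : SchemeOver ℂ} (hX : IsSmoothProjective n X) {θ : complexBetti X 2}
    (hθ : θ ∈ algebraicClasses X 1) : ∀ q : ℕ, cupPowTwo θ q ∈ algebraicClasses X q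
  | 0 => by
    rw [cupPowTwo_zero, algebraicClasses_zero]
    exact Submodule.mem_top
  | q + 1 => by
    rw [cupPowTwo_succ]
    exact cupProduct_mem_algebraicClasses_one_right hX (cupPowTwo_mem_algebraicClasses_of_mem hX hθ q) hθ

variable {n : ℕ} {𝒳 S : SchemeOver ℂ} {f : 𝒳 ⟶ S}

/-- The restriction of `Θ^q` to a smooth projective fibre on which `Θ|` is supported on a divisor is algebraic (`(Θ^q)| = (Θ|)^q`).
[cite: VoisinHodgeII2003, §9.2.4 Prop. 9.20] [cite: HatcherAT2002, Prop. 3.10] -/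
theorem map_cupPowTwo_mem_algebraicClasses (hf : IsSmoothProjectiveFamily f n) (Θ : complexBetti 𝒳 2) (s : ComplexPoints S)
    (hΘ : complexBetti.map (fiberι f s) 2 Θ ∈ algebraicClasses (fiberOver f s) 1) (q : ℕ) :
    complexBetti.map (fiberι f s) (2 * q) (cupPowTwo Θ q) ∈ algebraicClasses (fiberOver f s) q := by
  have h : complexBetti.map (fiberι f s) (2 * q) (cupPowTwo Θ q) = cupPowTwo (complexBetti.map (fiberι f s) 2 Θ) q :=
    map_cupPowTwo _ Θ q
  rw [h]
  exact cupPowTwo_mem_algebraicClasses_of_mem (hf.isSmoothProjective s) hΘ q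

/-- The restriction of `c · Θ^q` to a smooth projective fibre on which `Θ|` is of type `(1,1)` is of type `(q,q)`.
[cite: VoisinHodgeI2002, §7.1.2] [cite: HatcherAT2002, Prop. 3.10] -/
theorem isOfHodgeType_map_smul_cupPowTwo (hf : IsSmoothProjectiveFamily f n) (Θ : complexBetti 𝒳 2) (s : ComplexPoints S)
    (hΘ : IsOfHodgeType n (fiberOver f s) 2 1 1 (complexBetti.map (fiberι f s) 2 Θ)) (c : ℂ) (q : ℕ) :
    IsOfHodgeType n (fiberOver f s) (2 * q) q q (complexBetti.map (fiberι f s) (2 * q) (c • cupPowTwo Θ q)) := by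
  have h : complexBetti.map (fiberι f s) (2 * q) (cupPowTwo Θ q) = cupPowTwo (complexBetti.map (fiberι f s) 2 Θ) q :=
    map_cupPowTwo _ Θ q
  rw [map_smul, h]
  exact (isOfHodgeType_cupPowTwo (hf.isSmoothProjective s) hΘ q).smul c

/-- An affine `ℂ`-scheme is separated over `ℂ` (affine morphisms are separated). [folklore] -/
theorem isSeparated_hom_of_isAffine (S : SchemeOver ℂ) [IsAffine S.left] : IsSeparated S.hom :=
  IsSeparated.of_isAffineHom S.hom

/-! ## §2 The pinned design problem implies K-SR♭∃ at `(n, p)` — both regimes, every door -/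

/-- **THE PINNED DESIGN PROBLEM ON ONE ABELIAN VARIETY IMPLIES K-SR♭∃ AT `(n, p)`** (door-generic, fact-free). Given `PinnedDesignAt 𝒪 n p`, on
every one-parameter abelian scheme `f : 𝒳 ⟶ S` of the crux's shape and every fibrewise rational `(p,p)` global class `W` algebraic at `s₀`:
take the relative hyperplane class `Θ` (polarising every fibre: rational, supported on a divisor, hard Lefschetz), solve the design at
`X := 𝒳_{s₀}` with `θ := Θ|_{s₀}`, `w := W|_{s₀}`, and set `V_p := a·W + c_p·Θᵖ`, `V_q := c_q·Θ^q` (`q ≠ p`), `Z := c_p·Θᵖ` — a K-SR♭∃ datum at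
`s₁ := s₀` (`Z` is algebraic and Lefschetz on every fibre; the `V_q` restrict to `κ_q` at `s₀` and are of type `(q,q)` everywhere).
[cite: Bloch1972Semiregularity, Remark (7.5)] [cite: vanGeemen1994HodgeAV, §2.4] [cite: VoisinHodgeI2002, Thm. 6.25, Thm. 7.10 and §7.1.2] -/
theorem admissibleRepresentativesLefAtDeg_of_pinnedDesignAt {𝒪 : ObjClass} {n p : ℕ} (h : PinnedDesignAt 𝒪 n p) :
    AdmissibleRepresentativesLefAtDeg 𝒪 n p := by
  intro 𝒳 S f hf h𝒳 hirr haff hsm hdim habel hsec W hW s₀ hWs₀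
  haveI : IsSeparated S.hom := isSeparated_hom_of_isAffine S
  obtain ⟨Θ, hΘ⟩ := exists_forall_isPolarizationClass_map_fiberι f hf h𝒳
  obtain ⟨I, κ, a, c, hpI, h𝒪, ha, hκp, hκq⟩ :=
    h (fiberOver f s₀) (habel s₀) _ (hΘ s₀) _ (hW s₀).1 hWs₀
  have hΘQ : ∀ s : ComplexPoints S, IsRationalClass (complexBetti.map (fiberι f s) 2 Θ) := fun s ↦ (hΘ s).isRationalClass
  have hΘH : ∀ s : ComplexPoints S, IsOfHodgeType n (fiberOver f s) 2 1 1 (complexBetti.map (fiberι f s) 2 Θ) := fun s ↦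
    isOfHodgeType_of_mem_algebraicClasses_of_isSmoothProjective (hf.isSmoothProjective s) 1 (hΘ s).mem_algebraicClasses
  have hΘalg : ∀ s : ComplexPoints S,
      complexBetti.map (fiberι f s) (2 * p) (cupPowTwo Θ p) ∈ algebraicClasses (fiberOver f s) p := fun s ↦
    map_cupPowTwo_mem_algebraicClasses hf Θ s (hΘ s).mem_algebraicClasses p
  -- the global classes: `V_p := a·W + c_p·Θᵖ`, `V_q := c_q·Θ^q` for `q ≠ p`
  let V : (q : ℕ) → complexBetti 𝒳 (2 * q) :=
    Function.update (fun q ↦ c q • cupPowTwo Θ q) p (a • W + c p • cupPowTwo Θ p)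
  have hVp : V p = a • W + c p • cupPowTwo Θ p := Function.update_self _ _ _
  have hVq : ∀ q, q ≠ p → V q = c q • cupPowTwo Θ q := fun q hq ↦ Function.update_of_ne hq _ _
  refine lefAtDatum_of_pinned Θ hΘQ hΘH hΘalg W hpI h𝒪 ha hVp ?_ ?_
  · intro q hq
    by_cases hqp : q = p
    · subst hqp
      have hmap : complexBetti.map (fiberι f s₀) (2 * q) (cupPowTwo Θ q) = cupPowTwo (complexBetti.map (fiberι f s₀) 2 Θ) q :=
        map_cupPowTwo _ Θ q
      rw [hVp, map_add, map_smul, map_smul, hmap]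
      exact hκp
    · have hmap : complexBetti.map (fiberι f s₀) (2 * q) (cupPowTwo Θ q) = cupPowTwo (complexBetti.map (fiberι f s₀) 2 Θ) q :=
        map_cupPowTwo _ Θ q
      rw [hVq q hqp, map_smul, hmap]
      exact hκq q hq hqp
  · intro q hq s
    by_cases hqp : q = p
    · subst hqp
      rw [hVp, map_add, map_smul]
      exact ((hW s).2.smul a).add (hf.isSmoothProjective s) (isOfHodgeType_map_smul_cupPowTwo hf Θ s (hΘH s) (c q) q)
    · rw [hVq q hqp]
      exact isOfHodgeType_map_smul_cupPowTwo hf Θ s (hΘH s) (c q) q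

/-- **The pinned design problem implies REGIME 2 at `(n, p)`** (the cell of the road's crux), every door.
[cite: Bloch1972Semiregularity, Remark (7.5)] [cite: vanGeemen1994HodgeAV, §2.4] -/
theorem lefAtExceptionalRegimeAt_of_pinnedDesignAt {𝒪 : ObjClass} {n p : ℕ} (h : PinnedDesignAt 𝒪 n p) :
    LefAtExceptionalRegimeAt 𝒪 n p :=
  lefAtExceptionalRegimeAt_of_admissibleRepresentativesLefAtDeg (admissibleRepresentativesLefAtDeg_of_pinnedDesignAt h)

/-- **The pinned design problems in all bidegrees imply K-SR♭∃ for the door** (ungraded form `AdmissibleRepresentativesLefAt 𝒪`).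
[cite: Bloch1972Semiregularity, Remark (7.5)] [cite: vanGeemen1994HodgeAV, §2.4] -/
theorem admissibleRepresentativesLefAt_of_forall_pinnedDesignAt {𝒪 : ObjClass} (h : ∀ n p : ℕ, PinnedDesignAt 𝒪 n p) :
    AdmissibleRepresentativesLefAt 𝒪 :=
  admissibleRepresentativesLefAt_iff_forall_deg.2 fun n p ↦ admissibleRepresentativesLefAtDeg_of_pinnedDesignAt (h n p)

/-! ## §3 The pinned HODGE design problem implies regime 2 at `(n, p)` — the datum at the exceptional fibre -/

/-- **THE PINNED HODGE DESIGN PROBLEM IMPLIES REGIME 2 AT `(n, p)`** (door-generic, fact-free). In regime 2 the class `W` fails to be an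
algebraic Lefschetz class at SOME fibre `s₁`; Lefschetz classes being algebraic (`Dᵖ ⊗ ℂ ⊆ Nᵖ`, Lefschetz `(1,1)` and Voisin II Prop. 9.20 —
tree theorems), `W|_{s₁} ∉ Dᵖ(𝒳_{s₁}) ⊗ ℂ`; it is rational of type `(p,p)` there, so the Hodge design at `X := 𝒳_{s₁}`, `θ := Θ|_{s₁}` (relative
hyperplane class) gives the datum, completed by `V_p := a·W + c_p·Θᵖ`, `V_q := c_q·Θ^q`, `Z := c_p·Θᵖ` as in §2 — at that fibre, NOT at `s₀`.
[cite: Bloch1972Semiregularity, Remark (7.5)] [cite: vanGeemen1994HodgeAV, §2.4 and Thm. 4.11] [cite: VoisinHodgeI2002, Thm. 6.25 and §7.1.2] -/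
theorem lefAtExceptionalRegimeAt_of_pinnedHodgeDesignAt {𝒪 : ObjClass} {n p : ℕ} (h : PinnedHodgeDesignAt 𝒪 n p) :
    LefAtExceptionalRegimeAt 𝒪 n p := by
  intro 𝒳 S f hf h𝒳 hirr haff hsm hdim habel hsec W hW s₀ hWs₀ hexc
  haveI : IsSeparated S.hom := isSeparated_hom_of_isAffine S
  obtain ⟨Θ, hΘ⟩ := exists_forall_isPolarizationClass_map_fiberι f hf h𝒳
  -- a fibre where `W` is not an algebraic Lefschetz class
  obtain ⟨s₁, hs₁⟩ := not_forall.1 hexc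
  have hWD : complexBetti.map (fiberι f s₁) (2 * p) W ∉ divisorClassesSpan (fiberOver f s₁) n p := fun hD ↦
    hs₁ ⟨divisorClassesSpan_le_algebraicClasses_of_isSmoothProjective (hf.isSmoothProjective s₁) p hD, hD⟩
  obtain ⟨I, κ, a, c, hpI, h𝒪, ha, hκp, hκq⟩ :=
    h (fiberOver f s₁) (habel s₁) _ (hΘ s₁) _ (hW s₁).1 (hW s₁).2 hWD
  have hΘQ : ∀ s : ComplexPoints S, IsRationalClass (complexBetti.map (fiberι f s) 2 Θ) := fun s ↦ (hΘ s).isRationalClass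
  have hΘH : ∀ s : ComplexPoints S, IsOfHodgeType n (fiberOver f s) 2 1 1 (complexBetti.map (fiberι f s) 2 Θ) := fun s ↦
    isOfHodgeType_of_mem_algebraicClasses_of_isSmoothProjective (hf.isSmoothProjective s) 1 (hΘ s).mem_algebraicClasses
  have hΘalg : ∀ s : ComplexPoints S,
      complexBetti.map (fiberι f s) (2 * p) (cupPowTwo Θ p) ∈ algebraicClasses (fiberOver f s) p := fun s ↦
    map_cupPowTwo_mem_algebraicClasses hf Θ s (hΘ s).mem_algebraicClasses p
  let V : (q : ℕ) → complexBetti 𝒳 (2 * q) :=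
    Function.update (fun q ↦ c q • cupPowTwo Θ q) p (a • W + c p • cupPowTwo Θ p)
  have hVp : V p = a • W + c p • cupPowTwo Θ p := Function.update_self _ _ _
  have hVq : ∀ q, q ≠ p → V q = c q • cupPowTwo Θ q := fun q hq ↦ Function.update_of_ne hq _ _
  refine lefAtDatum_of_pinned Θ hΘQ hΘH hΘalg W hpI h𝒪 ha hVp ?_ ?_
  · intro q hq
    by_cases hqp : q = p
    · subst hqp
      have hmap : complexBetti.map (fiberι f s₁) (2 * q) (cupPowTwo Θ q) = cupPowTwo (complexBetti.map (fiberι f s₁) 2 Θ) q :=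
        map_cupPowTwo _ Θ q
      rw [hVp, map_add, map_smul, map_smul, hmap]
      exact hκp
    · have hmap : complexBetti.map (fiberι f s₁) (2 * q) (cupPowTwo Θ q) = cupPowTwo (complexBetti.map (fiberι f s₁) 2 Θ) q :=
        map_cupPowTwo _ Θ q
      rw [hVq q hqp, map_smul, hmap]
      exact hκq q hq hqp
  · intro q hq s
    by_cases hqp : q = p
    · subst hqp
      rw [hVp, map_add, map_smul]
      exact ((hW s).2.smul a).add (hf.isSmoothProjective s) (isOfHodgeType_map_smul_cupPowTwo hf Θ s (hΘH s) (c q) q)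
    · rw [hVq q hqp]
      exact isOfHodgeType_map_smul_cupPowTwo hf Θ s (hΘH s) (c q) q

/-! ## §4 Where the content is: off the `θ`-ray; the Hodge form from the algebraic form under HC in codimension `p` -/

/-- **Classes on the `θ`-ray are served by the null datum**: for a door with null data, if `w = t·θᵖ` then `I = {p}`, `κ = 0`, `a = 1`,
`c_p = −t` solve the pinned design at `(X, θ, w)` (`0 = 1·w + (−t)·θᵖ`). [cite: vanGeemen1994HodgeAV, §2.4] [cite: Fulton1998, Example 3.2.3] -/
theorem pinnedDesign_of_mem_span_cupPowTwo_of_hasNullDatum {𝒪 : ObjClass} (h𝒪 : HasNullDatum 𝒪) (n : ℕ) (X : SchemeOver ℂ)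
    (θ : complexBetti X 2) {p : ℕ} {w : complexBetti X (2 * p)} (hw : w ∈ ℂ ∙ cupPowTwo θ p) :
    ∃ (I : Finset ℕ) (κ : (q : ℕ) → complexBetti X (2 * q)) (a : ℂ) (c : ℕ → ℂ),
      p ∈ I ∧ 𝒪 n X I κ ∧ a ≠ 0 ∧ κ p = a • w + c p • cupPowTwo θ p ∧
      ∀ q ∈ I, q ≠ p → κ q = c q • cupPowTwo θ q := by
  obtain ⟨t, rfl⟩ := Submodule.mem_span_singleton.1 hw
  refine ⟨{p}, fun _ ↦ 0, 1, fun _ ↦ -t, Finset.mem_singleton_self p, h𝒪 n X p, one_ne_zero, ?_, ?_⟩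
  · rw [one_smul, neg_smul, add_neg_cancel]
  · intro q hq hqp
    exact absurd (Finset.mem_singleton.1 hq) hqp

/-- **For a door with null data the pinned design problem is its OFF-RAY part**: `PinnedDesignAt 𝒪 n p` holds iff it holds for the rational
algebraic classes `w ∉ ℂ · θᵖ` (at a variety with `B¹ = ℚ·θ` these are exactly the classes off `Dᵖ ⊗ ℂ = ℂ·θᵖ` — van Geemen's exceptional
classes; PART V `divisorClassesSpan_le_span_cupPowTwo`). [cite: vanGeemen1994HodgeAV, §2.4 and Thm. 4.11] [cite: Bloch1972Semiregularity, Remark (7.5)] -/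
theorem pinnedDesignAt_iff_offRay_of_hasNullDatum {𝒪 : ObjClass} (h𝒪 : HasNullDatum 𝒪) {n p : ℕ} :
    PinnedDesignAt 𝒪 n p ↔
      ∀ (X : SchemeOver ℂ), (∃ A : AbelianVariety ℂ, A.dim = n ∧ Nonempty (A.X ≅ X)) →
        ∀ (θ : complexBetti X 2), IsPolarizationClass n X θ →
        ∀ (w : complexBetti X (2 * p)), IsRationalClass w → w ∈ algebraicClasses X p → w ∉ ℂ ∙ cupPowTwo θ p →
          ∃ (I : Finset ℕ) (κ : (q : ℕ) → complexBetti X (2 * q)) (a : ℂ) (c : ℕ → ℂ),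
            p ∈ I ∧ 𝒪 n X I κ ∧ a ≠ 0 ∧ κ p = a • w + c p • cupPowTwo θ p ∧
            ∀ q ∈ I, q ≠ p → κ q = c q • cupPowTwo θ q := by
  refine ⟨fun h X hX θ hθ w hwQ hwalg _ ↦ h X hX θ hθ w hwQ hwalg, fun h X hX θ hθ w hwQ hwalg ↦ ?_⟩
  by_cases hray : w ∈ ℂ ∙ cupPowTwo θ p
  · exact pinnedDesign_of_mem_span_cupPowTwo_of_hasNullDatum h𝒪 n X θ hray
  · exact h X hX θ hθ w hwQ hwalg hray

/-- **Under the Hodge conjecture in codimension `p` for the varieties concerned, the algebraic form implies the Hodge form**: if on every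
complex scheme isomorphic to an abelian `n`-fold every rational `(p,p)`-class is algebraic, then `PinnedDesignAt 𝒪 n p → PinnedHodgeDesignAt 𝒪 n p`
(e.g. `n ≤ 3`, or `p = 1` by Lefschetz `(1,1)` — there the cell is void anyway). [cite: vanGeemen1994HodgeAV, §2.4] [cite: Bloch1972Semiregularity, Remark (7.5)] -/
theorem pinnedHodgeDesignAt_of_pinnedDesignAt_of_hodge {𝒪 : ObjClass} {n p : ℕ}
    (hHC : ∀ (X : SchemeOver ℂ), (∃ A : AbelianVariety ℂ, A.dim = n ∧ Nonempty (A.X ≅ X)) →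
      ∀ w : complexBetti X (2 * p), IsRationalClass w → IsOfHodgeType n X (2 * p) p p w → w ∈ algebraicClasses X p)
    (h : PinnedDesignAt 𝒪 n p) : PinnedHodgeDesignAt 𝒪 n p :=
  fun X hX θ hθ w hwQ hwH _ ↦ h X hX θ hθ w hwQ (hHC X hX w hwQ hwH)

/-- **Conversely the Hodge form serves the algebraic classes off the Lefschetz span** (algebraic classes are of type `(p,p)`, Voisin I
Prop. 11.20 on the carriers): `PinnedHodgeDesignAt 𝒪 n p` gives the pinned design at every `(X, θ, w)` with `w` rational algebraic and
`w ∉ Dᵖ(X) ⊗ ℂ`. [cite: VoisinHodgeI2002, §11.1.2 Prop. 11.20] [cite: vanGeemen1994HodgeAV, §2.4] -/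
theorem pinnedDesign_of_pinnedHodgeDesignAt_of_not_mem {𝒪 : ObjClass} {n p : ℕ} (h : PinnedHodgeDesignAt 𝒪 n p)
    (X : SchemeOver ℂ) (hX : ∃ A : AbelianVariety ℂ, A.dim = n ∧ Nonempty (A.X ≅ X)) (θ : complexBetti X 2)
    (hθ : IsPolarizationClass n X θ) (w : complexBetti X (2 * p)) (hwQ : IsRationalClass w) (hwalg : w ∈ algebraicClasses X p)
    (hwD : w ∉ divisorClassesSpan X n p) :
    ∃ (I : Finset ℕ) (κ : (q : ℕ) → complexBetti X (2 * q)) (a : ℂ) (c : ℕ → ℂ),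
      p ∈ I ∧ 𝒪 n X I κ ∧ a ≠ 0 ∧ κ p = a • w + c p • cupPowTwo θ p ∧
      ∀ q ∈ I, q ≠ p → κ q = c q • cupPowTwo θ q := by
  obtain ⟨A, hA, ⟨e⟩⟩ := hX
  have hAX : IsSmoothProjective n A.X := hA ▸ AbelianVariety.isSmoothProjective_holds (A := A)
  have hXsp : IsSmoothProjective n X := hAX.of_iso e
  exact h X ⟨A, hA, ⟨e⟩⟩ θ hθ w hwQ (isOfHodgeType_of_mem_algebraicClasses_of_isSmoothProjective hXsp p hwalg) hwD

/-! ## §5 Per pencil, per fibre: ONE pinned datum at ONE fibre is a K-SR♭∃ datum for that pencil (ab-andre-2 gen 57, appended)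

The engine of §2/§3 isolated, for use with PER-VARIETY inputs that are known at SPECIAL fibres only (e.g. Markman's secant sheaves at
the anchor sixfold `X × X̂` of a split Weil component, [cite: Markman2025SecantWeil, Thm. 1.4.1]): the polarising class need not be the
relative hyperplane class — ANY global `Θ ∈ H²(𝒳(ℂ); ℂ)` with rational `(1,1)` restrictions will do (a global polarisation of a polarised
family, for instance), and nothing is asked at the other fibres. -/

/-- **ONE PINNED DATUM AT ONE FIBRE IS A K-SR♭∃ DATUM** (door-generic, fact-free). `f : 𝒳 ⟶ S` a smooth projective family of relative
dimension `n`, `Θ ∈ H²(𝒳(ℂ); ℂ)` a global class with rational `(1,1)` restrictions on every fibre, `W ∈ H^{2p}(𝒳(ℂ); ℂ)` with `(p,p)`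
restrictions on every fibre. If at ONE fibre `s₁` there is an `𝒪`-admissible `(I ∋ p, κ)` with `κ_p = a·W|_{s₁} + c_p·(Θ|_{s₁})ᵖ`, `a ≠ 0`,
and `κ_q = c_q·(Θ|_{s₁})^q` for `q ∈ I`, `q ≠ p`, then the conclusion of K-SR♭∃ holds for `(f, W)`: `V_p := a·W + c_p·Θᵖ`, `V_q := c_q·Θ^q`,
`Z := c_p·Θᵖ` (algebraic and Lefschetz on every fibre: `Dᵖ ⊗ ℂ ⊆ Nᵖ`, Lefschetz `(1,1)`), at `s₁`. §2 and §3 are the instances `Θ :=`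
relative hyperplane class, `s₁ := s₀` / the exceptional fibre. [cite: Bloch1972Semiregularity, Remark (7.5)] [cite: vanGeemen1994HodgeAV, §2.4]
[cite: VoisinHodgeI2002, Thm. 11.30 and §7.1.2] -/
theorem exists_lefAtDatum_of_pinnedDatum_at {𝒪 : ObjClass} (hf : IsSmoothProjectiveFamily f n) (Θ : complexBetti 𝒳 2)
    (hΘQ : ∀ s : ComplexPoints S, IsRationalClass (complexBetti.map (fiberι f s) 2 Θ))
    (hΘH : ∀ s : ComplexPoints S, IsOfHodgeType n (fiberOver f s) 2 1 1 (complexBetti.map (fiberι f s) 2 Θ))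
    {p : ℕ} (W : complexBetti 𝒳 (2 * p))
    (hWH : ∀ s : ComplexPoints S, IsOfHodgeType n (fiberOver f s) (2 * p) p p (complexBetti.map (fiberι f s) (2 * p) W))
    {s₁ : ComplexPoints S} {I : Finset ℕ} {κ : (q : ℕ) → complexBetti (fiberOver f s₁) (2 * q)} {a : ℂ} {c : ℕ → ℂ}
    (hpI : p ∈ I) (h𝒪 : 𝒪 n (fiberOver f s₁) I κ) (ha : a ≠ 0)
    (hκp : κ p = a • complexBetti.map (fiberι f s₁) (2 * p) W + c p • cupPowTwo (complexBetti.map (fiberι f s₁) 2 Θ) p)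
    (hκq : ∀ q ∈ I, q ≠ p → κ q = c q • cupPowTwo (complexBetti.map (fiberι f s₁) 2 Θ) q) :
    ∃ (s₁ : ComplexPoints S) (I : Finset ℕ) (κ : (q : ℕ) → complexBetti (fiberOver f s₁) (2 * q))
      (V : (q : ℕ) → complexBetti 𝒳 (2 * q)) (a : ℂ) (Z : complexBetti 𝒳 (2 * p)),
      p ∈ I ∧ 𝒪 n (fiberOver f s₁) I κ ∧ a ≠ 0 ∧
      (∀ s : ComplexPoints S,
        complexBetti.map (fiberι f s) (2 * p) Z ∈ algebraicClasses (fiberOver f s) p ∧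
        complexBetti.map (fiberι f s) (2 * p) Z ∈ divisorClassesSpan (fiberOver f s) n p) ∧
      V p = a • W + Z ∧
      (∀ q ∈ I, κ q = complexBetti.map (fiberι f s₁) (2 * q) (V q)) ∧
      (∀ q ∈ I, ∀ s : ComplexPoints S, IsOfHodgeType n (fiberOver f s) (2 * q) q q (complexBetti.map (fiberι f s) (2 * q) (V q))) := by
  -- `(Θᵖ)|` is a Lefschetz class, hence algebraic, on every fibre
  have hΘalg : ∀ s : ComplexPoints S,
      complexBetti.map (fiberι f s) (2 * p) (cupPowTwo Θ p) ∈ algebraicClasses (fiberOver f s) p := fun s ↦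
    divisorClassesSpan_le_algebraicClasses_of_isSmoothProjective (hf.isSmoothProjective s) p
      (by simpa only [one_smul] using smul_cupPowTwo_map_mem_divisorClassesSpan Θ s (hΘQ s) (hΘH s) 1 p)
  let V : (q : ℕ) → complexBetti 𝒳 (2 * q) :=
    Function.update (fun q ↦ c q • cupPowTwo Θ q) p (a • W + c p • cupPowTwo Θ p)
  have hVp : V p = a • W + c p • cupPowTwo Θ p := Function.update_self _ _ _
  have hVq : ∀ q, q ≠ p → V q = c q • cupPowTwo Θ q := fun q hq ↦ Function.update_of_ne hq _ _
  refine lefAtDatum_of_pinned Θ hΘQ hΘH hΘalg W hpI h𝒪 ha hVp ?_ ?_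
  · intro q hq
    by_cases hqp : q = p
    · subst hqp
      have hmap : complexBetti.map (fiberι f s₁) (2 * q) (cupPowTwo Θ q) = cupPowTwo (complexBetti.map (fiberι f s₁) 2 Θ) q :=
        map_cupPowTwo _ Θ q
      rw [hVp, map_add, map_smul, map_smul, hmap]
      exact hκp
    · have hmap : complexBetti.map (fiberι f s₁) (2 * q) (cupPowTwo Θ q) = cupPowTwo (complexBetti.map (fiberι f s₁) 2 Θ) q :=
        map_cupPowTwo _ Θ q
      rw [hVq q hqp, map_smul, hmap]
      exact hκq q hq hqp
  · intro q hq s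
    by_cases hqp : q = p
    · subst hqp
      rw [hVp, map_add, map_smul]
      exact ((hWH s).smul a).add (hf.isSmoothProjective s) (isOfHodgeType_map_smul_cupPowTwo hf Θ s (hΘH s) (c q) q)
    · rw [hVq q hqp]
      exact isOfHodgeType_map_smul_cupPowTwo hf Θ s (hΘH s) (c q) q

/-- **Regime 2 at `(n, p)` for ONE pencil from ONE pinned datum at ONE of its fibres, with the relative hyperplane class as `Θ`** — the
binders of `LefAtExceptionalRegimeAt 𝒪 n p` for a single pencil and the per-fibre hypothesis «at SOME fibre `s₁`, for EVERY polarisation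
class `θ` of `𝒳_{s₁}`, a pinned datum for `(W|_{s₁}, θ)`» (so the hypothesis does not depend on which polarisation the total space
induces). [cite: Bloch1972Semiregularity, Remark (7.5)] [cite: VoisinHodgeI2002, Thm. 6.25, Thm. 7.10 and §7.1.2] -/
theorem exists_lefAtDatum_of_pinnedDesign_at_fibre {𝒪 : ObjClass} (hf : IsSmoothProjectiveFamily f n) (h𝒳 : IsQuasiProjectiveOver 𝒳)
    [IsAffine S.left] {p : ℕ} (W : complexBetti 𝒳 (2 * p))
    (hWH : ∀ s : ComplexPoints S, IsOfHodgeType n (fiberOver f s) (2 * p) p p (complexBetti.map (fiberι f s) (2 * p) W))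
    (s₁ : ComplexPoints S)
    (hdesign : ∀ θ : complexBetti (fiberOver f s₁) 2, IsPolarizationClass n (fiberOver f s₁) θ →
      ∃ (I : Finset ℕ) (κ : (q : ℕ) → complexBetti (fiberOver f s₁) (2 * q)) (a : ℂ) (c : ℕ → ℂ),
        p ∈ I ∧ 𝒪 n (fiberOver f s₁) I κ ∧ a ≠ 0 ∧
        κ p = a • complexBetti.map (fiberι f s₁) (2 * p) W + c p • cupPowTwo θ p ∧
        ∀ q ∈ I, q ≠ p → κ q = c q • cupPowTwo θ q) :
    ∃ (s₁ : ComplexPoints S) (I : Finset ℕ) (κ : (q : ℕ) → complexBetti (fiberOver f s₁) (2 * q))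
      (V : (q : ℕ) → complexBetti 𝒳 (2 * q)) (a : ℂ) (Z : complexBetti 𝒳 (2 * p)),
      p ∈ I ∧ 𝒪 n (fiberOver f s₁) I κ ∧ a ≠ 0 ∧
      (∀ s : ComplexPoints S,
        complexBetti.map (fiberι f s) (2 * p) Z ∈ algebraicClasses (fiberOver f s) p ∧
        complexBetti.map (fiberι f s) (2 * p) Z ∈ divisorClassesSpan (fiberOver f s) n p) ∧
      V p = a • W + Z ∧
      (∀ q ∈ I, κ q = complexBetti.map (fiberι f s₁) (2 * q) (V q)) ∧
      (∀ q ∈ I, ∀ s : ComplexPoints S, IsOfHodgeType n (fiberOver f s) (2 * q) q q (complexBetti.map (fiberι f s) (2 * q) (V q))) := by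
  haveI : IsSeparated S.hom := isSeparated_hom_of_isAffine S
  obtain ⟨Θ, hΘ⟩ := exists_forall_isPolarizationClass_map_fiberι f hf h𝒳
  obtain ⟨I, κ, a, c, hpI, h𝒪, ha, hκp, hκq⟩ := hdesign _ (hΘ s₁)
  have hΘQ : ∀ s : ComplexPoints S, IsRationalClass (complexBetti.map (fiberι f s) 2 Θ) := fun s ↦ (hΘ s).isRationalClass
  have hΘH : ∀ s : ComplexPoints S, IsOfHodgeType n (fiberOver f s) 2 1 1 (complexBetti.map (fiberι f s) 2 Θ) := fun s ↦
    isOfHodgeType_of_mem_algebraicClasses_of_isSmoothProjective (hf.isSmoothProjective s) 1 (hΘ s).mem_algebraicClasses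
  exact exists_lefAtDatum_of_pinnedDatum_at hf Θ hΘQ hΘH W hWH hpI h𝒪 ha hκp hκq

end Summit.HodgeConjecture.HodgeConjecture.Ring2.SemiregularRepresentatives

end
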